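import Literature.NumberTheory.Automorphic.HeckeTraceFormulaGL2Level
import Literature.NumberTheory.EllipticCurves.NewformsSpanProofs
import Literature.NumberTheory.EllipticCurves.NewformsMainLemmaProofs
import Literature.NumberTheory.EllipticCurves.NewformsLiftProofs
import Literature.NumberTheory.EllipticCurves.NewformsRealCoefficients
import HarnessLib

/-!
# Murty–Sinha's multiplicity bound: the spectral side `Tr T_{p^m} = Σ_i P_m(a_{p,i})`

Sibling file of `Literature.NumberTheory.EllipticCurves.MurtySinhaMultiplicity` (named fact
`murtySinha2009_eigenvalue_multiplicity_weightTwo`, M. R. Murty, K. Sinha, J. Number Theory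
**129** (2009) 681–714 [MurtySinha2009], eq. (1) p. 683) and of `MurtySinhaMultiplicityProofs`
(the combinatorial core, Thm. 22). This file supplies the **spectral side** of the argument of
loc. cit. §§7–8 (p. 697, Lemma 17 and the displayed identities
`Σ_{i ≤ r} 2 cos mθ_i = Tr T'_{p^m} - Tr T'_{p^{m-2}}`): it connects the left-hand side
`cuspidalHeckeTrace N k 1 n = Tr(T_n | S_k(N, 𝟙))` of the tree's Eichler–Selberg trace formula
(`Literature.NumberTheory.Automorphic.HeckeTraceFormulaGL2Level`, Schoof–van der Vlugt Thm. 2.2)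
for `n = p^m`, `p ∤ N`, with the eigenvalues of the tree's `heckeT (Gamma0 N) k p` on
`S_k(Γ₀(N))`, counted with the multiplicities `dim Eig(T_p, μ)` that the named fact bounds.

## Main result

`MurtySinha.heckeT_gamma0_spectralData N k p` (`p` prime, `p ∤ N`): there is a finite set
`E ⊂ ℂ` (the eigenvalues of `T_p` on `S_k(Γ₀(N))`) such that

* every `μ ∈ E` is real (`conj μ = μ`; Diamond–Shurman Thm. 5.5.3, `heckeT_selfAdjoint_holds`);
* `Eig(T_p, μ) = 0` for `μ ∉ E`;
* `dim S_k(Γ₀(N)) = Σ_{μ ∈ E} dim Eig(T_p, μ)` (**`T_p` is diagonalisable**: `S_k(Γ₀(N))` is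
  finite-dimensional, `finiteDimensional_cuspForm_gamma0`, and a self-adjoint operator for the
  definite Hermitian Petersson form has no Jordan blocks,
  `maxGenEigenspace_eq_eigenspace_of_selfAdjoint`; Diamond–Shurman Thm. 5.5.4);
* for every sequence of functions `Q_m` with `Q_0 = 1`, `Q_1(μ) = μ`,
  `Q_{m+2}(μ) = μ Q_{m+1}(μ) - p^{k-1} Q_m(μ)` on `E` (i.e. `Q_m(μ) = p^{m(k-1)/2} X_m(μ/p^{(k-1)/2})`,
  Murty–Sinha Lemma 17: "`T'_{p^m} = X_m(T'_p)`") and every `m ≥ 0`,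
  `Tr(T_{p^m} | S_k(N, 𝟙)) = Σ_{μ ∈ E} dim Eig(T_p, μ) · Q_m(μ)`.

The last item is the bridge `S_k(Γ₀(N)) ≅ S_k(N, 𝟙) ⊂ S_k(Γ₁(N))` (`liftToGamma1`, injective with
image the `𝟙`-eigenspace of the diamond operators: `liftToGamma1_injective`,
`diamondOp_liftToGamma1`, `exists_liftToGamma1_eq_of_forall_diamondOp_eq`; Diamond–Shurman §4.3,
§5.2), the compatibility `T_p ∘ lift = lift ∘ T_p` (`heckeT_liftToGamma1`, Diamond–Shurman
Ex. 5.2.4), the definition of `T_{p^m}` on `S_k(Γ₁(N))` by the recursion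
`T_{p^{m+2}} = T_p T_{p^{m+1}} - p^{k-1} ⟨p⟩ T_{p^m}` (`heckeTPrimePow`, Diamond–Shurman §5.3) with
`⟨p⟩ = 1` on `S_k(N, 𝟙)`, and the block-diagonal computation of the trace on the eigenspace
decomposition (Mathlib `LinearMap.trace_eq_sum_trace_restrict'`, `LinearMap.trace_conj'`).
The statement is kept free of new definitions (the polynomials `Q_m` enter through their
recursion), so that the assembly can take `Q_m(μ) = (√p)^m X_m(μ/√p)` in weight `2`.

## References

* [MurtySinha2009] §8, p. 697 (Lemma 17: `T'_{p^m} = X_m(T'_p)`; `Σ 2cos mθ_i = Tr T'_{p^m} - Tr T'_{p^{m-2}}`).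
* [DiamondShurman2005] §5.3 (definition of `T_{p^r}`), Thm. 5.5.3–5.5.4, Ex. 5.2.4.
* [SchoofVandervlugt1991] Thm. 2.2 (the trace `Tr(T_n | S_k(N, χ))` on the left-hand side).
-/

noncomputable section

open scoped MatrixGroups ModularForm ComplexConjugate

open CongruenceSubgroup

namespace Literature.NumberTheory.EllipticCurves.ModularForms

namespace MurtySinha

open Literature.NumberTheory.Automorphic
open Literature.NumberTheory.Automorphic.HeckeTraceFormulaGL2Level

variable (N : ℕ) [NeZero N] (k : ℤ)

/-! ### `S_k(Γ₀(N)) ≅ S_k(N, 𝟙)` -/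

/-- Membership in `S_k(N, 𝟙)`: `f ∈ nebentypusSubspace N k 1 ↔ ⟨d⟩ f = f` for all units `d`
(Diamond–Shurman §5.2, p. 169: `S_k(N, χ)` is the `χ`-eigenspace of the diamond operators).
[cite: DiamondShurman2005, §5.2 p. 169] -/
theorem mem_nebentypusSubspace_one_iff (f : CuspForm (Gamma1 N) k) :
    f ∈ nebentypusSubspace N k 1 ↔ ∀ d : (ZMod N)ˣ, diamondOp N k (d : ZMod N) f = f := by
  simp only [nebentypusSubspace, Submodule.mem_iInf, LinearMap.mem_ker, LinearMap.sub_apply,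
    LinearMap.id_apply, MulChar.one_apply_coe, one_smul, sub_eq_zero]

/-- The lift of a `Γ₀(N)`-form lies in `S_k(N, 𝟙)` (Diamond–Shurman §4.3, p. 119:
`S_k(Γ₀(N)) = S_k(N, 𝟙)`; `diamondOp_liftToGamma1`). [cite: DiamondShurman2005, §4.3 p. 119] -/
theorem liftToGamma1_mem_nebentypusSubspace_one (f : CuspForm (Gamma0 N) k) :
    liftToGamma1 N k f ∈ nebentypusSubspace N k 1 :=
  (mem_nebentypusSubspace_one_iff N k _).2 fun d ↦ diamondOp_liftToGamma1 N k (d : ZMod N) f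

/-- Every element of `S_k(N, 𝟙)` is the lift of a `Γ₀(N)`-form (Diamond–Shurman §4.3, p. 119;
`exists_liftToGamma1_eq_of_forall_diamondOp_eq`). [cite: DiamondShurman2005, §4.3 p. 119] -/
theorem exists_liftToGamma1_eq_of_mem_nebentypusSubspace_one {g : CuspForm (Gamma1 N) k}
    (hg : g ∈ nebentypusSubspace N k 1) : ∃ f : CuspForm (Gamma0 N) k, liftToGamma1 N k f = g := by
  refine exists_liftToGamma1_eq_of_forall_diamondOp_eq k g fun d hd ↦ ?_
  obtain ⟨u, rfl⟩ := hd
  exact (mem_nebentypusSubspace_one_iff N k g).1 hg u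

/-! ### `T_n` for prime powers -/

/-- For a prime `p`, `heckeTn N k (p ^ m)` is the recursively defined `T_{p^m}`
(`heckeTPrimePow`; Diamond–Shurman §5.3). [cite: DiamondShurman2005, §5.3 (definition of T_n)] -/
theorem heckeTn_prime_pow (p : ℕ) [NeZero p] (hp : p.Prime) (m : ℕ) :
    heckeTn N k (p ^ m) = heckeTPrimePow N k p m := by
  rcases Nat.eq_zero_or_pos m with rfl | hm
  · simp [heckeTPrimePow]
  · have h0 : p ≠ 0 := hp.ne_zero
    simp [heckeTn, Nat.primeFactors_prime_pow hm.ne' hp, Finset.sort_singleton, h0,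
      hp.factorization_self]

/-- The recursion `T_{p^{m+2}} = T_p T_{p^{m+1}} - p^{k-1} ⟨p⟩ T_{p^m}` (definitional unfolding of
`heckeTPrimePow`; Diamond–Shurman §5.3). [cite: DiamondShurman2005, §5.3 (definition of T_{p^r})] -/
theorem heckeTPrimePow_add_two (p : ℕ) [NeZero p] (m : ℕ) :
    heckeTPrimePow N k p (m + 2) = heckeT (Gamma1 N) k p * heckeTPrimePow N k p (m + 1) -
      (p : ℂ) ^ (k - 1) • (diamondOrZero N k p * heckeTPrimePow N k p m) := by
  rw [heckeTPrimePow]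

/-! ### The spectral data of `T_p` on `S_k(Γ₀(N))` -/

omit [NeZero N] in
/-- **Trace on an eigenspace decomposition.** If `S` acts on each eigenspace `Eig(T, μ)` of an
endomorphism `T` of the finite-dimensional space `S_k(Γ₀(N))` as the scalar `s(μ)`, and the
eigenspaces of `T` span (i.e. `T` is diagonalisable), then `Tr S = Σ_μ dim Eig(T, μ) · s(μ)`
(block-diagonal matrices; Mathlib `LinearMap.trace_eq_sum_trace_restrict'`). [folklore] -/
theorem trace_eq_sum_finrank_eigenspace_mul [FiniteDimensional ℂ (CuspForm (Gamma0 N) k)]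
    (T : Module.End ℂ (CuspForm (Gamma0 N) k)) (htop : ⨆ μ, T.eigenspace μ = ⊤)
    (hfin : {μ : ℂ | T.eigenspace μ ≠ ⊥}.Finite) (S : Module.End ℂ (CuspForm (Gamma0 N) k))
    (s : ℂ → ℂ) (hS : ∀ μ, ∀ v ∈ T.eigenspace μ, S v = s μ • v) :
    LinearMap.trace ℂ _ S =
      ∑ μ ∈ hfin.toFinset, (Module.finrank ℂ (T.eigenspace μ) : ℂ) * s μ := by
  classical
  have hint : DirectSum.IsInternal T.eigenspace :=
    DirectSum.isInternal_submodule_of_iSupIndep_of_iSup_eq_top T.eigenspaces_iSupIndep htop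
  have hmaps : ∀ μ, Set.MapsTo S (T.eigenspace μ) (T.eigenspace μ) := fun μ v hv ↦ by
    have hv' : v ∈ T.eigenspace μ := hv
    show S v ∈ T.eigenspace μ
    rw [hS μ v hv']
    exact Submodule.smul_mem _ _ hv'
  rw [LinearMap.trace_eq_sum_trace_restrict' hint hfin hmaps]
  refine Finset.sum_congr rfl fun μ _ ↦ ?_
  have hres : S.restrict (hmaps μ) = s μ • LinearMap.id := by
    ext ⟨v, hv⟩
    rw [LinearMap.coe_restrict_apply, LinearMap.smul_apply, LinearMap.id_apply, Submodule.coe_smul,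
      hS μ v hv]
  rw [hres, map_smul, LinearMap.trace_id, smul_eq_mul, mul_comm]

/-- **Spectral data of `T_p` on `S_k(Γ₀(N))`, `p ∤ N`** (Murty–Sinha §8, p. 697, Lemma 17 and
the identity `Σ_{i ≤ r} X_m(a_{p,i}/p^{(k-1)/2}) = Tr T'_{p^m}`, with the eigenvalues `a_{p,i}`
"counted with multiplicity"). There is a finite set `E` of complex numbers (the eigenvalues of
`T_p = heckeT (Gamma0 N) k p`) such that: (i) each `μ ∈ E` is real (self-adjointness,
Diamond–Shurman Thm. 5.5.3); (ii) `Eig(T_p, μ) = 0` for `μ ∉ E`; (iii) `dim S_k(Γ₀(N)) =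
Σ_{μ ∈ E} dim Eig(T_p, μ)` (`T_p` is diagonalisable, Diamond–Shurman Thm. 5.5.4); (iv) for all
functions `Q_m` satisfying on `E` the recursion `Q_0 = 1`, `Q_1(μ) = μ`,
`Q_{m+2}(μ) = μ Q_{m+1}(μ) - p^{k-1} Q_m(μ)` of `T_{p^m}` (Diamond–Shurman §5.3), the trace of
`T_{p^m}` on `S_k(N, 𝟙) ≅ S_k(Γ₀(N))` — the left-hand side `cuspidalHeckeTrace N k 1 (p^m)` of the
Eichler–Selberg trace formula `HeckeTraceFormulaGL2Level` — equals `Σ_{μ ∈ E} dim Eig(T_p, μ) Q_m(μ)`.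
[cite: MurtySinha2009, §8 p. 697 (Lemma 17 and the trace identities)] -/
theorem heckeT_gamma0_spectralData (p : ℕ) [NeZero p] (hp : p.Prime) (hpN : ¬ p ∣ N) :
    ∃ E : Finset ℂ,
      (∀ μ ∈ E, conj μ = μ) ∧
      (∀ μ : ℂ, μ ∉ E → Module.End.eigenspace (heckeT (Gamma0 N) k p) μ = ⊥) ∧
      ((Module.finrank ℂ (CuspForm (Gamma0 N) k) : ℂ) =
        ∑ μ ∈ E, (Module.finrank ℂ (Module.End.eigenspace (heckeT (Gamma0 N) k p) μ) : ℂ)) ∧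
      ∀ Q : ℕ → ℂ → ℂ, (∀ μ ∈ E, Q 0 μ = 1) → (∀ μ ∈ E, Q 1 μ = μ) →
        (∀ μ ∈ E, ∀ m : ℕ, Q (m + 2) μ = μ * Q (m + 1) μ - (p : ℂ) ^ (k - 1) * Q m μ) →
        ∀ m : ℕ, cuspidalHeckeTrace N k 1 (p ^ m) =
          ∑ μ ∈ E, (Module.finrank ℂ (Module.End.eigenspace (heckeT (Gamma0 N) k p) μ) : ℂ) *
            Q m μ := by
  classical
  haveI : FiniteDimensional ℂ (CuspForm (Gamma0 N) k) := finiteDimensional_cuspForm_gamma0 N k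
  set T : Module.End ℂ (CuspForm (Gamma0 N) k) := heckeT (Gamma0 N) k p with hT_def
  -- (B) generalised eigenspaces are eigenspaces; the eigenspaces span; finitely many eigenvalues
  have hgen : ∀ μ, T.maxGenEigenspace μ = T.eigenspace μ := fun μ ↦
    maxGenEigenspace_eq_eigenspace_of_selfAdjoint
      (fun x y ↦ peterssonProduct (Gamma0 N) k x y)
      (fun u v w ↦ peterssonProduct_add_right k u v w)
      (fun c v w ↦ peterssonProduct_smul_right (Gamma0 N) k c v w)
      (fun v w ↦ peterssonProduct_conj_symm_holds (Gamma0 N) k v w)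
      (fun v hv ↦ eq_zero_of_peterssonProduct_self_eq_zero k v hv)
      T (fun v w ↦ heckeT_selfAdjoint_holds N k p hp hpN v w) μ
  have htop : ⨆ μ, T.eigenspace μ = ⊤ := by
    have h := Module.End.iSup_maxGenEigenspace_eq_top T
    simp_rw [hgen] at h
    exact h
  have hfin : {μ : ℂ | T.eigenspace μ ≠ ⊥}.Finite := T.finite_hasEigenvalue
  set E : Finset ℂ := hfin.toFinset with hE_def
  have hmemE : ∀ μ, μ ∈ E ↔ T.eigenspace μ ≠ ⊥ := fun μ ↦ by
    rw [hE_def, Set.Finite.mem_toFinset, Set.mem_setOf_eq]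
  -- the trace of an operator acting by scalars on the eigenspaces
  have hK : ∀ (S : Module.End ℂ (CuspForm (Gamma0 N) k)) (s : ℂ → ℂ),
      (∀ μ ∈ E, ∀ v ∈ T.eigenspace μ, S v = s μ • v) →
      LinearMap.trace ℂ _ S = ∑ μ ∈ E, (Module.finrank ℂ (T.eigenspace μ) : ℂ) * s μ := by
    intro S s hS
    refine trace_eq_sum_finrank_eigenspace_mul N k T htop hfin S s fun μ v hv ↦ ?_
    by_cases hμ : μ ∈ E
    · exact hS μ hμ v hv
    · have hbot : T.eigenspace μ = ⊥ := not_ne_iff.mp ((hmemE μ).not.mp hμ)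
      rw [hbot, Submodule.mem_bot] at hv
      rw [hv, map_zero, smul_zero]
  refine ⟨E, fun μ hμ ↦ ?_, fun μ hμ ↦ not_ne_iff.mp ((hmemE μ).not.mp hμ), ?_, ?_⟩
  · -- (i) eigenvalues are real
    have hμ' : T.HasEigenvalue μ := (hmemE μ).mp hμ
    obtain ⟨f, hf⟩ := hμ'.exists_hasEigenvector
    exact conj_eq_of_heckeT_eq_smul hp hpN hf.2 hf.apply_eq_smul
  · -- (iii) the dimension, as the trace of the identity
    have h := hK 1 (fun _ ↦ 1) (fun μ _ v _ ↦ by rw [Module.End.one_apply, one_smul])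
    rw [LinearMap.trace_one] at h
    simpa using h
  · -- (iv) the trace of `T_{p^m}` on `S_k(N, 𝟙)`
    intro Q hQ0 hQ1 hQ2 m
    have hcop : Nat.Coprime p N := (Nat.Prime.coprime_iff_not_dvd hp).2 hpN
    set L : CuspForm (Gamma0 N) k →ₗ[ℂ] CuspForm (Gamma1 N) k := liftToGamma1 N k with hL_def
    set W : Submodule ℂ (CuspForm (Gamma1 N) k) := nebentypusSubspace N k 1 with hW_def
    have hLW : ∀ v, L v ∈ W := liftToGamma1_mem_nebentypusSubspace_one N k
    have hD : ∀ v, diamondOrZero N k p (L v) = L v := fun v ↦ by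
      rw [diamondOrZero, if_pos hcop]
      exact diamondOp_liftToGamma1 N k _ v
    -- `T_p`, `⟨p⟩` and hence all `T_{p^m}` preserve `W = S_k(N, 𝟙)`
    have hT1W : ∀ w ∈ W, heckeT (Gamma1 N) k p w ∈ W := by
      intro w hw
      obtain ⟨v, rfl⟩ := exists_liftToGamma1_eq_of_mem_nebentypusSubspace_one N k hw
      rw [heckeT_liftToGamma1 N k p v]
      exact hLW _
    have hDW : ∀ w ∈ W, diamondOrZero N k p w ∈ W := by
      intro w hw
      obtain ⟨v, rfl⟩ := exists_liftToGamma1_eq_of_mem_nebentypusSubspace_one N k hw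
      rw [hD v]
      exact hLW v
    have hPW : ∀ m, ∀ w ∈ W, heckeTPrimePow N k p m w ∈ W := by
      have key : ∀ m, (∀ w ∈ W, heckeTPrimePow N k p m w ∈ W) ∧
          (∀ w ∈ W, heckeTPrimePow N k p (m + 1) w ∈ W) := by
        intro m
        induction m with
        | zero =>
          exact ⟨fun w hw ↦ by simpa [heckeTPrimePow] using hw,
            fun w hw ↦ by simpa [heckeTPrimePow] using hT1W w hw⟩
        | succ m ih =>
          refine ⟨ih.2, fun w hw ↦ ?_⟩
          rw [heckeTPrimePow_add_two, LinearMap.sub_apply, LinearMap.smul_apply,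
            Module.End.mul_apply, Module.End.mul_apply]
          exact W.sub_mem (hT1W _ (ih.2 w hw)) (W.smul_mem _ (hDW _ (ih.1 w hw)))
      exact fun m ↦ (key m).1
    -- on an eigenvector, `T_{p^m}` acts by `Q_m(μ)`
    have hPL : ∀ μ ∈ E, ∀ v, T v = μ • v → ∀ m, heckeTPrimePow N k p m (L v) = Q m μ • L v := by
      intro μ hμ v hv
      have hT1 : heckeT (Gamma1 N) k p (L v) = μ • L v := by
        rw [hL_def, heckeT_liftToGamma1 N k p v, ← hT_def, hv, map_smul]
      have key : ∀ m, heckeTPrimePow N k p m (L v) = Q m μ • L v ∧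
          heckeTPrimePow N k p (m + 1) (L v) = Q (m + 1) μ • L v := by
        intro m
        induction m with
        | zero =>
          refine ⟨?_, ?_⟩
          · simp [heckeTPrimePow, hQ0 μ hμ]
          · simp [heckeTPrimePow, hT1, hQ1 μ hμ]
        | succ m ih =>
          refine ⟨ih.2, ?_⟩
          rw [heckeTPrimePow_add_two, LinearMap.sub_apply, LinearMap.smul_apply,
            Module.End.mul_apply, Module.End.mul_apply, ih.1, map_smul, hD, ih.2, map_smul, hT1,
            hQ2 μ hμ m, smul_smul, smul_smul, ← sub_smul, mul_comm (Q (m + 1) μ) μ]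
      exact fun m ↦ (key m).1
    -- the isomorphism `e : S_k(Γ₀(N)) ≃ W`
    let Lc : CuspForm (Gamma0 N) k →ₗ[ℂ] W := LinearMap.codRestrict W L hLW
    have hinj : Function.Injective Lc := by
      intro a b h
      apply liftToGamma1_injective N k
      have := congrArg (Subtype.val : W → CuspForm (Gamma1 N) k) h
      simpa [Lc] using this
    have hsurj : Function.Surjective Lc := by
      rintro ⟨w, hw⟩
      obtain ⟨v, rfl⟩ := exists_liftToGamma1_eq_of_mem_nebentypusSubspace_one N k hw
      exact ⟨v, rfl⟩
    let e : CuspForm (Gamma0 N) k ≃ₗ[ℂ] W := LinearEquiv.ofBijective Lc ⟨hinj, hsurj⟩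
    have he : ∀ v, ((e v : W) : CuspForm (Gamma1 N) k) = L v := fun v ↦ rfl
    -- the trace computation
    set Pm : Module.End ℂ W := (heckeTPrimePow N k p m).restrict (hPW m) with hPm_def
    have hS : ∀ μ ∈ E, ∀ v ∈ T.eigenspace μ, e.symm.conj Pm v = Q m μ • v := by
      intro μ hμ v hv
      rw [LinearEquiv.conj_apply_apply, LinearEquiv.symm_symm]
      apply e.injective
      rw [LinearEquiv.apply_symm_apply, map_smul]
      apply Subtype.ext
      rw [hPm_def, LinearMap.coe_restrict_apply, Submodule.coe_smul, he,
        hPL μ hμ v (Module.End.mem_eigenspace_iff.mp hv) m]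
    calc cuspidalHeckeTrace N k 1 (p ^ m)
        = traceOn (heckeTPrimePow N k p m) W := by
          rw [cuspidalHeckeTrace, heckeTn_prime_pow N k p hp m]
      _ = LinearMap.trace ℂ W Pm := traceOn_eq_trace_restrict _ _ (hPW m)
      _ = LinearMap.trace ℂ (CuspForm (Gamma0 N) k) (e.symm.conj Pm) :=
          (LinearMap.trace_conj' Pm e.symm).symm
      _ = ∑ μ ∈ E, (Module.finrank ℂ (T.eigenspace μ) : ℂ) * Q m μ := hK _ (Q m) hS

end MurtySinha

end Literature.NumberTheory.EllipticCurves.ModularForms
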